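import Summits.CriticalPhenomena.CardyFormulaZ2.Theorems.CardyUniqueLimitCardyRigidityLevelExtension
import Summits.CriticalPhenomena.CardyFormulaZ2.Theorems.CardyUniqueLimitCardyRigidityFarFieldMeasurable
import HarnessLib

/-!
# Mark flows of driving paths started near `0`: measurability, level box, adaptedness (line `crossing-martingale`, crux `CardyRigidity`)

First helper file of stub `stub_martingaleOfData` (PASSAGE of the crossing-martingale property to
a scaling limit; crux `CardyRigidity`, stmt-CriticalPhenomena-0746; vocabulary of
`Theorems/CardyUniqueLimitCardyRigidityDefs.lean`).  The passage theorem
`Loewner.integral_cylinder_eq_zero_of_discreteMartingales_of_ae_continuousAt` consumes the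
level-stopped crossing observable as a functional on the WHOLE driving-path space `C([0,∞), ℝ)`
(canonical process `w ↦ (r ↦ w r)`), where paths need not start at `0`; the measurability layer
`FarFieldMeasurable.lean` and the level-box lemmas of `LevelExtension.lean` assume `W 0 = 0`
identically.  This file removes that assumption where the passage needs it:

* `measurable_realFlowStop_of_lt` — for a measurable family of continuous driving paths ALL
  STARTED STRICTLY BELOW the mark `y` (`W ω 0 < y`), the frozen real flow `ω ↦ X^y_t(W ω)` is a
  measurable functional of the path up to time `t` (the proof of
  `Loewner.measurable_realFlowTrunc`, which only ever used `W ω 0 < y`);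
* pathwise facts for ONE continuous path: every mark flow is continuous in time
  (`continuous_markFlow_pt`, including the degenerate mark `y = W 0`, whose frozen flow is `0`),
  and the level box `marks_mem_box_pt` for a path started in the window
  `x₀ - M < W 0 < x₀ - m` (the three mark flows then start inside the level box);
* the adaptedness chain of `FarFieldMeasurable.lean` for driving processes whose paths all start
  below `x₀ - m`: `adapted_markFlow'`, `isStoppingTime_levelTime'`,
  `stronglyMeasurable_etaProc_stopped'`, `measurable_etaProc_stopped'`.
-/

noncomputable section

open MeasureTheory Filter Set Topology
open scoped NNReal ENNReal
open Literature.Probability.RandomPlanarGeometry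
open Literature.Probability.Process (exitTime coe_untopA_min_le)

namespace Summit.CriticalPhenomena.CardyFormulaZ2.Cruxes.CardyRigidity.CrossingMartingale

namespace MartingaleOfData

/-! ### The frozen real flow of a family of paths started below the mark is measurable -/

section LoewnerMeasurable

open Loewner

variable {Ω : Type*} {mΩ : MeasurableSpace Ω} {W : Ω → ℝ≥0 → ℝ} {t : ℝ≥0}

/-- `{t < T_x} = ⋃ₙ farEvent n` for paths started strictly below `x` and `t > 0` (the proof of
`Loewner.setOf_lt_swallowingTime_eq_iUnion`, which only uses `W ω 0 < x`). [folklore] -/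
theorem setOf_lt_swallowingTime_eq_iUnion' (hc : ∀ ω, Continuous (W ω)) {x : ℝ}
    (hx : ∀ ω, W ω 0 < x) (ht : 0 < t) :
    {ω | (t : WithTop ℝ≥0) < swallowingTime (W ω) x} = ⋃ n, farEvent W t hc x n := by
  -- adapted from Literature/Probability/RandomPlanarGeometry/LoewnerAdapted.lean
  ext ω
  simp only [mem_setOf_eq, mem_iUnion]
  have hx' : W ω 0 < x := hx ω
  have hx0 : (x : ℂ) ≠ W ω 0 := fun h ↦ hx'.ne' (by exact_mod_cast h)
  constructor
  · intro hlt
    obtain ⟨g, hg⟩ := exists_isSolution_swallowingTime_holds (hc ω) hx0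
    obtain ⟨m, hm, hfar⟩ := exists_far_of_lt_swallowingTime hc ω hx' hg hlt
    obtain ⟨n, hn⟩ := exists_nat_one_div_lt (half_pos hm)
    refine ⟨n, mem_iInter.2 fun q hq ↦ ?_⟩
    have hnm : 1 / (n + 1 : ℝ) ≤ m := by linarith
    rw [truncFlow_eq_re hc ω hg hlt n hnm hfar hq]
    linarith [hfar q hq]
  · rintro ⟨n, hn⟩
    have hn' := mem_iInter.1 hn
    have hcontF : Continuous fun s ↦ truncFlow (t := t) hc (one_div_succ_pos n) x ω s -
        W ω s.toNNReal :=
      (continuous_truncFlow hc _ x ω).sub ((hc ω).comp continuous_real_toNNReal)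
    have hall := forall_Icc_le_of_forall_rat hcontF t.coe_nonneg fun q hq ↦ hn' q hq
    exact lt_swallowingTime_of_truncSol_far (hc ω) (one_div_succ_pos n) ht (truncFlow_zero hc _ x ω)
      (fun s hs ↦ hasDerivWithinAt_truncFlow hc _ x ω hs) hall

/-- The event `{t < T_x}` is measurable for a measurable family of continuous paths started
strictly below `x`. [cite: Lawler2005, Ch. 4 §4.1] -/
theorem measurableSet_lt_swallowingTime' (hc : ∀ ω, Continuous (W ω)) {x : ℝ}
    (hx : ∀ ω, W ω 0 < x) (hmeas : ∀ s, s ≤ t → Measurable fun ω ↦ W ω s) :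
    MeasurableSet {ω | (t : WithTop ℝ≥0) < swallowingTime (W ω) x} := by
  -- adapted from Literature/Probability/RandomPlanarGeometry/LoewnerAdapted.lean
  rcases (zero_le : (0 : ℝ≥0) ≤ t).eq_or_lt with ht | ht
  · have : {ω | (t : WithTop ℝ≥0) < swallowingTime (W ω) x} = univ := by
      refine eq_univ_of_forall fun ω ↦ ?_
      rw [mem_setOf_eq, ← ht]
      exact swallowingTime_pos_holds (hc ω) (fun h ↦ (hx ω).ne' (by exact_mod_cast h))
    rw [this]
    exact MeasurableSet.univ
  · rw [setOf_lt_swallowingTime_eq_iUnion' hc hx ht]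
    exact MeasurableSet.iUnion fun n ↦ measurableSet_farEvent hc hmeas x n

/-- **The frozen real flow is a measurable functional of the path up to the present, for paths
started strictly below the mark**: `ω ↦ realFlowStop (W ω) x t` is measurable with respect to any
σ-algebra making the path values at times `≤ t` measurable (continuous paths, `W ω 0 < x` for all
`ω`).  The proof of `Loewner.measurable_realFlowTrunc` verbatim. [cite: Lawler2005, Ch. 4 §4.1] -/
theorem measurable_realFlowStop_of_lt (hc : ∀ ω, Continuous (W ω)) {x : ℝ} (hx : ∀ ω, W ω 0 < x)
    (hmeas : ∀ s, s ≤ t → Measurable fun ω ↦ W ω s) :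
    Measurable fun ω ↦ realFlowStop (W ω) x t := by
  -- adapted from Literature/Probability/RandomPlanarGeometry/LoewnerAdapted.lean
  classical
  set E := {ω | (t : WithTop ℝ≥0) < swallowingTime (W ω) x} with hE
  have hEm : MeasurableSet E := measurableSet_lt_swallowingTime' hc hx hmeas
  set G : ℕ → Ω → ℝ := fun n ω ↦ if ω ∈ E then
    truncFlow (t := t) hc (one_div_succ_pos n) x ω t - W ω t else 0 with hG
  have hGm : ∀ n, Measurable (G n) := fun n ↦
    Measurable.ite hEm ((measurable_truncFlow hc hmeas _ x _).sub (hmeas t le_rfl)) measurable_const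
  refine measurable_of_tendsto_metrizable hGm (tendsto_pi_nhds.2 fun ω ↦ ?_)
  by_cases hω : ω ∈ E
  · have hlt : (t : WithTop ℝ≥0) < swallowingTime (W ω) x := hω
    simp only [hG, if_pos hω]
    rw [realFlowStop_of_lt hlt, realFlow_apply]
    have hx' : W ω 0 < x := hx ω
    have hx0 : (x : ℂ) ≠ W ω 0 := fun h ↦ hx'.ne' (by exact_mod_cast h)
    obtain ⟨g, hg⟩ := exists_isSolution_swallowingTime_holds (hc ω) hx0
    obtain ⟨m, hm, hfar⟩ := exists_far_of_lt_swallowingTime hc ω hx' hg hlt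
    obtain ⟨n₀, hn₀⟩ := exists_nat_one_div_lt hm
    refine tendsto_const_nhds.congr' ?_
    filter_upwards [eventually_ge_atTop n₀] with n hn
    have hnm : 1 / (n + 1 : ℝ) ≤ m := by
      have h1 : (1 : ℝ) / (n + 1) ≤ 1 / (n₀ + 1) :=
        one_div_le_one_div_of_le (by positivity) (by exact_mod_cast Nat.succ_le_succ hn)
      linarith
    have heq := truncFlow_eq_re hc ω hg hlt n hnm hfar ⟨t.coe_nonneg, le_rfl⟩
    simp only at heq
    rw [heq, map_eq_of_isSolution (hc ω) hg hlt]
  · have hle : ¬ (t : WithTop ℝ≥0) < swallowingTime (W ω) x := hω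
    simp only [hG, if_neg hω]
    rw [realFlowStop_of_le (not_lt.1 hle)]
    exact tendsto_const_nhds

end LoewnerMeasurable

/-! ### Pathwise facts: continuity of every mark flow, the level box for a path started in the window -/

section Pointwise

variable {Ω : Type*} {W : Ω → ℝ≥0 → ℝ} {ω : Ω} {x : Fin 3 → ℝ} {m M d : ℝ}

/-- **Every mark flow of a continuous driving path is continuous in time**: for a mark `y ≠ W 0`
this is `Loewner.continuous_realFlowStop_of_ne`, and the frozen flow of the singular mark
`y = W 0` is identically `0` (`Loewner.swallowingTime_driving_le`). [folklore] -/
theorem continuous_markFlow_pt (hc : Continuous (W ω)) (y : ℝ) :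
    Continuous fun s ↦ markFlow W y s ω := by
  by_cases hy : y = W ω 0
  · have h0 : ∀ s : ℝ≥0, markFlow W y s ω = 0 := fun s ↦ by
      show Loewner.realFlowStop (W ω) y s = 0
      refine Loewner.realFlowStop_of_le ?_
      rw [hy]
      exact (Loewner.swallowingTime_driving_le (W ω)).trans zero_le
    simp only [h0]
    exact continuous_const
  · exact Loewner.continuous_realFlowStop_of_ne hc hy

/-- The flow of a mark `y ≠ W 0` starts at `y - W 0`. [folklore] -/
theorem markFlow_zero_pt (hc : Continuous (W ω)) {y : ℝ} (hy : y ≠ W ω 0) :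
    markFlow W y 0 ω = y - W ω 0 :=
  Loewner.realFlowStop_zero_of_ne hc hy

/-- For admissible data, a start `W 0 < x₀ - m` lies strictly below every mark. [folklore] -/
theorem start_lt_mark (h : AdmissibleLevels x m M d) {c : ℝ} (hc : c < x 0 - m) (i : Fin 3) :
    c < x i := by
  have h1 := h.m_pos
  have h2 := h.strictMono.monotone (Fin.zero_le i)
  linarith

/-- **The level box, pathwise.**  For a continuous driving path started in the window
`x₀ - M < W 0 < x₀ - m` (so that the mark flows start inside the level box) and admissible data,
at every clock `τ ≤ levelTime` the first mark flow is in `[m, M]` and the two gaps are in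
`[d, x₂ - x₀ + 1]`. [cite: Werner2007, §3] -/
theorem marks_mem_box_pt (hc : Continuous (W ω)) (h : AdmissibleLevels x m M d)
    (hw : W ω 0 ∈ Ioo (x 0 - M) (x 0 - m)) {τ : ℝ≥0}
    (hτ : (τ : WithTop ℝ≥0) ≤ levelTime W x m M d ω) :
    markFlow W (x 0) τ ω ∈ Icc m M ∧
      markFlow W (x 1) τ ω - markFlow W (x 0) τ ω ∈ Icc d (x 2 - x 0 + 1) ∧
      markFlow W (x 2) τ ω - markFlow W (x 1) τ ω ∈ Icc d (x 2 - x 0 + 1) := by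
  have hx01 : x 0 < x 1 := h.strictMono (by decide)
  have hx12 : x 1 < x 2 := h.strictMono (by decide)
  have hcont := fun i ↦ continuous_markFlow_pt (W := W) hc (x i)
  have hzero : ∀ i, markFlow W (x i) 0 ω = x i - W ω 0 := fun i ↦
    markFlow_zero_pt hc (start_lt_mark h hw.2 i).ne'
  have hw1 := hw.1
  have hw2 := hw.2
  refine ⟨?_, ?_, ?_⟩
  · refine mem_Icc_of_le_exitTime (hcont 0) ?_ (hτ.trans (min_le_left _ _))
    rw [hzero 0]
    constructor <;> linarith
  · refine mem_Icc_of_le_exitTime (u := fun s ω ↦ markFlow W (x 1) s ω - markFlow W (x 0) s ω)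
      ((hcont 1).sub (hcont 0)) ?_ (hτ.trans ((min_le_right _ _).trans (min_le_left _ _)))
    show markFlow W (x 1) 0 ω - markFlow W (x 0) 0 ω ∈ Ioo d (x 2 - x 0 + 1)
    rw [hzero 1, hzero 0]
    constructor <;> linarith [h.d_lt₁]
  · refine mem_Icc_of_le_exitTime (u := fun s ω ↦ markFlow W (x 2) s ω - markFlow W (x 1) s ω)
      ((hcont 2).sub (hcont 1)) ?_ (hτ.trans ((min_le_right _ _).trans (min_le_right _ _)))
    show markFlow W (x 2) 0 ω - markFlow W (x 1) 0 ω ∈ Ioo d (x 2 - x 0 + 1)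
    rw [hzero 2, hzero 1]
    constructor <;> linarith [h.d_lt₂]

/-- At a clock before the level time the marks are positive and ordered with gaps `≥ d`:
`0 < m ≤ X⁰`, `X⁰ + d ≤ X¹`, `X¹ + d ≤ X²` (path started in the window). [folklore] -/
theorem marks_pos_pt (hc : Continuous (W ω)) (h : AdmissibleLevels x m M d)
    (hw : W ω 0 ∈ Ioo (x 0 - M) (x 0 - m)) {τ : ℝ≥0}
    (hτ : (τ : WithTop ℝ≥0) ≤ levelTime W x m M d ω) :
    0 < markFlow W (x 0) τ ω ∧ markFlow W (x 0) τ ω < markFlow W (x 1) τ ω ∧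
      markFlow W (x 1) τ ω < markFlow W (x 2) τ ω := by
  obtain ⟨hX0, hg1, hg2⟩ := marks_mem_box_pt hc h hw hτ
  refine ⟨h.m_pos.trans_le hX0.1, ?_, ?_⟩
  · linarith [hg1.1, h.d_pos]
  · linarith [hg2.1, h.d_pos]

/-- The modulus is continuous in time at every clock before the level time (path started in the
window): the denominators of `cardyEta` do not vanish there. [folklore] -/
theorem continuousAt_etaProc_pt (hc : Continuous (W ω)) (h : AdmissibleLevels x m M d)
    (hw : W ω 0 ∈ Ioo (x 0 - M) (x 0 - m)) {τ : ℝ≥0}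
    (hτ : (τ : WithTop ℝ≥0) ≤ levelTime W x m M d ω) :
    ContinuousAt (fun s ↦ etaProc W x s ω) τ := by
  have hcont := fun i ↦ continuous_markFlow_pt (W := W) hc (x i)
  obtain ⟨h0, h01, h12⟩ := marks_pos_pt hc h hw hτ
  have hden : markFlow W (x 1) τ ω * (markFlow W (x 2) τ ω - markFlow W (x 0) τ ω) ≠ 0 := by
    have h1 : 0 < markFlow W (x 1) τ ω := h0.trans h01
    have h2 : 0 < markFlow W (x 2) τ ω - markFlow W (x 0) τ ω := by linarith
    positivity
  simp only [etaProc, cardyEta]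
  exact (((hcont 0).continuousAt).mul
    ((hcont 2).continuousAt.sub (hcont 1).continuousAt)).div
    (((hcont 1).continuousAt).mul ((hcont 2).continuousAt.sub (hcont 0).continuousAt)) hden

end Pointwise

/-! ### Adaptedness for driving processes started below `x₀ - m` -/

section Adapted

variable {Ω : Type*} {mΩ : MeasurableSpace Ω} {W : Ω → ℝ≥0 → ℝ} {𝓕 : Filtration ℝ≥0 mΩ}
  {x : Fin 3 → ℝ} {m M d : ℝ}

/-- **The frozen flow of a mark lying strictly above every starting point is adapted** to any
filtration to which the driving process (continuous paths) is strongly adapted.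
[cite: Lawler2005, Ch. 4 §4.1] -/
theorem adapted_markFlow' (hWad : StronglyAdapted 𝓕 (fun t ω ↦ W ω t))
    (hWc : ∀ ω, Continuous (W ω)) {y : ℝ} (hy : ∀ ω, W ω 0 < y) :
    Adapted 𝓕 (markFlow W y) := by
  intro t
  have hmeas : ∀ s, s ≤ t → Measurable[𝓕 t] fun ω ↦ W ω s := fun s hs ↦
    ((hWad s).measurable).mono (𝓕.mono hs) le_rfl
  exact measurable_realFlowStop_of_lt (mΩ := 𝓕 t) (W := W) (t := t) hWc hy hmeas

/-- **The level time is a stopping time** (driving process strongly adapted, continuous paths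
started below `x₀ - m`, admissible data). [folklore] -/
theorem isStoppingTime_levelTime' (hWad : StronglyAdapted 𝓕 (fun t ω ↦ W ω t))
    (hWc : ∀ ω, Continuous (W ω)) (h : AdmissibleLevels x m M d)
    (hs : ∀ ω, W ω 0 < x 0 - m) : IsStoppingTime 𝓕 (levelTime W x m M d) := by
  have had : ∀ i, Adapted 𝓕 (markFlow W (x i)) := fun i ↦
    adapted_markFlow' hWad hWc fun ω ↦ start_lt_mark h (hs ω) i
  have hc : ∀ i ω, Continuous fun t ↦ markFlow W (x i) t ω := fun i ω ↦
    continuous_markFlow_pt (hWc ω) (x i)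
  have h0 : IsStoppingTime 𝓕 (exitTime (markFlow W (x 0)) m M) :=
    Literature.Probability.Process.isStoppingTime_exitTime (had 0) (hc 0)
  have h1 : IsStoppingTime 𝓕
      (exitTime (fun t ω ↦ markFlow W (x 1) t ω - markFlow W (x 0) t ω) d (x 2 - x 0 + 1)) :=
    Literature.Probability.Process.isStoppingTime_exitTime (fun t ↦ (had 1 t).sub (had 0 t))
      (fun ω ↦ (hc 1 ω).sub (hc 0 ω))
  have h2 : IsStoppingTime 𝓕
      (exitTime (fun t ω ↦ markFlow W (x 2) t ω - markFlow W (x 1) t ω) d (x 2 - x 0 + 1)) :=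
    Literature.Probability.Process.isStoppingTime_exitTime (fun t ↦ (had 2 t).sub (had 1 t))
      (fun ω ↦ (hc 2 ω).sub (hc 1 ω))
  exact h0.min (h1.min h2)

/-- The mark flows stopped at the level time are strongly adapted (paths started below
`x₀ - m`). [folklore] -/
theorem stronglyAdapted_stoppedProcess_markFlow' (hWad : StronglyAdapted 𝓕 (fun t ω ↦ W ω t))
    (hWc : ∀ ω, Continuous (W ω)) (h : AdmissibleLevels x m M d)
    (hs : ∀ ω, W ω 0 < x 0 - m) (i : Fin 3) :
    StronglyAdapted 𝓕 (stoppedProcess (markFlow W (x i)) (levelTime W x m M d)) := by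
  have had : Adapted 𝓕 (markFlow W (x i)) :=
    adapted_markFlow' hWad hWc fun ω ↦ start_lt_mark h (hs ω) i
  exact (StronglyAdapted.isStronglyProgressive_of_continuous (fun t ↦ (had t).stronglyMeasurable)
    (fun ω ↦ continuous_markFlow_pt (hWc ω) (x i))).stronglyAdapted_stoppedProcess
    (isStoppingTime_levelTime' hWad hWc h hs)

/-- **The modulus at the stopped clock is strongly measurable** with respect to `𝓕 t` (paths
started below `x₀ - m`). [folklore] -/
theorem stronglyMeasurable_etaProc_stopped' (hWad : StronglyAdapted 𝓕 (fun t ω ↦ W ω t))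
    (hWc : ∀ ω, Continuous (W ω)) (h : AdmissibleLevels x m M d)
    (hs : ∀ ω, W ω 0 < x 0 - m) (t : ℝ≥0) :
    StronglyMeasurable[𝓕 t] fun ω ↦
      etaProc W x (min (t : WithTop ℝ≥0) (levelTime W x m M d ω)).untopA ω := by
  have hS := fun i ↦ stronglyAdapted_stoppedProcess_markFlow' hWad hWc h hs i t
  have hfun : (fun ω ↦ etaProc W x (min (t : WithTop ℝ≥0) (levelTime W x m M d ω)).untopA ω) =
      fun ω ↦ cardyEta (stoppedProcess (markFlow W (x 0)) (levelTime W x m M d) t ω)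
        (stoppedProcess (markFlow W (x 1)) (levelTime W x m M d) t ω)
        (stoppedProcess (markFlow W (x 2)) (levelTime W x m M d) t ω) := by
    funext ω
    rfl
  rw [hfun]
  simp only [cardyEta]
  exact ((hS 0).mul ((hS 2).sub (hS 1))).div ((hS 1).mul ((hS 2).sub (hS 0)))

/-- The modulus at the stopped clock is measurable for the ambient σ-algebra (paths started below
`x₀ - m`). [folklore] -/
theorem measurable_etaProc_stopped' (hWad : StronglyAdapted 𝓕 (fun t ω ↦ W ω t))
    (hWc : ∀ ω, Continuous (W ω)) (h : AdmissibleLevels x m M d)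
    (hs : ∀ ω, W ω 0 < x 0 - m) (t : ℝ≥0) :
    Measurable fun ω ↦ etaProc W x (min (t : WithTop ℝ≥0) (levelTime W x m M d ω)).untopA ω :=
  ((stronglyMeasurable_etaProc_stopped' hWad hWc h hs t).measurable).mono (𝓕.le t) le_rfl

end Adapted

end MartingaleOfData

/-- **Registered form** (glue sub-goal `martingaleOfData_measurable_realFlowStop` of
stmt-CriticalPhenomena-0746): the frozen real Loewner flow at time `t` of a mark `y` is a
measurable functional of a measurable family of continuous driving paths all started strictly
below `y`, with respect to any σ-algebra making the path values at times `≤ t` measurable.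
[cite: Lawler2005, Ch. 4 §4.1] -/
theorem martingaleOfData_measurable_realFlowStop : ∀ {Ω : Type*} {mΩ : MeasurableSpace Ω} {W : Ω → ℝ≥0 → ℝ} {t : ℝ≥0}, (∀ ω, Continuous (W ω)) → ∀ {y : ℝ}, (∀ ω, W ω 0 < y) → (∀ s, s ≤ t → Measurable fun ω ↦ W ω s) → Measurable fun ω ↦ Literature.Probability.RandomPlanarGeometry.Loewner.realFlowStop (W ω) y t :=
  fun hc _ hy hmeas ↦ MartingaleOfData.measurable_realFlowStop_of_lt hc hy hmeas

end Summit.CriticalPhenomena.CardyFormulaZ2.Cruxes.CardyRigidity.CrossingMartingale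

end
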